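import Summits.HubbardSuperconductivity.HubbardSuperconductivity.Theorems.FunctionFieldCertificateMesoscopicPairOrderNecessity
import Literature.MathematicalPhysics.QuantumLattice.HubbardRingPerronFrobeniusProofs
import HarnessLib

/-!
# Crux `MesoscopicPairOrder` (stmt-HubbardSuperconductivity-7331) — sector stationarity of every ground state

Support file for the crux (route `FunctionFieldCertificate`, pole-free half; line `Sketch`, lead c1).
The crux quantifies over EVERY normalised ground state `ψ` of `H_L = hubbardTorus 2 L 1 U` in the
joint sector `(N_L, S^z = 0)`, `N_L = 2⌊(1-δ)L²/2⌋` even. The only state-independent information a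
certificate (the route's `Q†[H,Q]` channel, a finite-range SOS+KKT family, or the window constraints
of card `window-stationarity-box-transfer`) can use about such a `ψ` is STATIONARITY: first-order
stability of the energy against perturbations `Q`. This file proves it in the strongest cheap form:

* `le_card_of_isGroundStateInSector` — a ground state of the `(2n, 0)` sector forces `n ≤ |Λ_L|`;
* `sectorStationarity` (registered sub-goal) — for every ground state `ψ` of `H_L` in the sector
  `(2n, S^z = 0)` and EVERY particle-number-preserving matrix `Q` (no `S^z`-preservation, no
  locality, no normalisation of `ψ` needed): `0 ≤ Re⟨Qψ, (H_L Q - Q H_L) ψ⟩`.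
  Proof: `(H Q - Q H)ψ = (H - E₀) Qψ` with `E₀ = E_{(2n,0)}(H_L)`, and by `SU(2)` the joint-sector
  ground energy IS the plain `2n`-particle ground energy (`groundEnergyAt_eq_minEnergyOn_szSector`:
  every spin multiplet meets `S^z = 0`), below the Rayleigh quotient of the `2n`-particle vector
  `Qψ` (`LiebThm1.groundEnergy_mul_norm_le`).

So the `S^z = 0` restriction of the crux costs a certificate nothing: its KKT generators may be ANY
`N`-preserving operators (pair hoppings, local rotations, Cooper pair transfers), not only the
`szSector`-preserving ones of the route's `CertifiedSectorLRO`. Sources: Lieb, PRL 62 (1989) 1201,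
proof of Thm 1 (all competitors have an `S^z = 0` representative); Pironio–Navascués–Acín, SIAM J.
Optim. 20 (2010) 2157 and Fawzi–Fawzi–Scalet (2024) (first-order / KKT ground-state constraints).
Folklore; no definition is introduced.
-/

noncomputable section

-- the summit namespace `Summit.HubbardSuperconductivity.HubbardSuperconductivity.…` repeats the problem name by design (D-0017)
set_option linter.dupNamespace false

namespace Summit.HubbardSuperconductivity.HubbardSuperconductivity.Theorems.FunctionFieldCertificate

open Matrix Finset Filter
open Literature.Probability.LatticeModels Literature.MathematicalPhysics.QuantumLattice
open scoped ComplexOrder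

/-- A ground state of the joint sector `(2n, S^z = 0)` on the torus `Λ_L` forces `n ≤ |Λ_L|`
(a nonzero vector of Lieb's `(n, n)` sector has a nonzero coefficient on an occupation set with `n`
up-spins). Lieb, PRL 62 (1989) 1201. [folklore] -/
theorem le_card_of_isGroundStateInSector (L : ℕ) {n : ℕ}
    {H : Matrix (Finset (Orb (FermionTorus 2 L))) (Finset (Orb (FermionTorus 2 L))) ℂ}
    {ψ : Fock (Orb (FermionTorus 2 L))} (hgs : IsGroundStateInSector H (2 * n) 0 ψ) :
    n ≤ Fintype.card (FermionTorus 2 L) := by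
  by_contra hlt
  have hlt' := not_le.mp hlt
  apply hgs.2.1
  funext s
  refine (mem_szSector_two_mul_zero_iff n ψ).1 hgs.1 s fun h => ?_
  have : (upPart s).card ≤ Fintype.card (FermionTorus 2 L) := Finset.card_le_univ _
  omega

/-- **Sector stationarity** (registered sub-goal `sectorStationarity` of crux
stmt-HubbardSuperconductivity-7331). For every ground state `ψ` of `H_L = hubbardTorus 2 L 1 U` in
the joint sector `(2n, S^z = 0)` and EVERY particle-number-preserving matrix `Q`:
`0 ≤ Re⟨Qψ, (H_L Q - Q H_L) ψ⟩`. Indeed `(H_L Q - Q H_L)ψ = H_L(Qψ) - E₀ Qψ` with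
`E₀ = E_{(2n,0)}(H_L)`, which by `SU(2)` equals the `2n`-particle ground energy
(`groundEnergyAt_eq_minEnergyOn_szSector`), and `E₀ ‖Qψ‖² ≤ Re⟨Qψ, H_L Qψ⟩` for the `2n`-particle
vector `Qψ` (`LiebThm1.groundEnergy_mul_norm_le`). No `S^z`-preservation, locality or normalisation
is needed. Lieb, PRL 62 (1989) 1201, proof of Thm 1; Pironio–Navascués–Acín (2010) §2. [folklore] -/
theorem sectorStationarity : ∀ (U : ℝ) (L n : ℕ) [NeZero L] (ψ : Fock (Orb (FermionTorus 2 L))), IsGroundStateInSector (hubbardTorus 2 L 1 U) (2 * n) 0 ψ → ∀ Q : Matrix (Finset (Orb (FermionTorus 2 L))) (Finset (Orb (FermionTorus 2 L))) ℂ, (∀ φ : Fock (Orb (FermionTorus 2 L)), IsNParticle (2 * n) φ → IsNParticle (2 * n) (Q *ᵥ φ)) → 0 ≤ (star (Q *ᵥ ψ) ⬝ᵥ ((hubbardTorus 2 L 1 U * Q - Q * hubbardTorus 2 L 1 U) *ᵥ ψ)).re := by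
  intro U L n _ ψ hgs Q hQ
  set H := hubbardTorus 2 L 1 U with hH
  set E₀ : ℝ := H.minEnergyOn (szSector (2 * n) 0) with hE₀
  obtain ⟨hψK, hne, heig⟩ := hgs
  -- `SU(2)`: the joint-sector ground energy is the `2n`-particle ground energy
  have hn : n ≤ Fintype.card (FermionTorus 2 L) := le_card_of_isGroundStateInSector L ⟨hψK, hne, heig⟩
  have hSU2 : groundEnergy H (2 * n) = E₀ :=
    groundEnergyAt_eq_minEnergyOn_szSector (fermionTorusGraph 2 L) 1 U hn
  -- `Qψ` is a `2n`-particle vector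
  have hψN : IsNParticle (2 * n) ψ := ((mem_szSector_iff _ _ _).1 hψK).1
  have hQψN : IsNParticle (2 * n) (Q *ᵥ ψ) := hQ ψ hψN
  -- the commutator acting on the ground state
  have hcomm : (H * Q - Q * H) *ᵥ ψ = H *ᵥ (Q *ᵥ ψ) - ((E₀ : ℝ) : ℂ) • (Q *ᵥ ψ) := by
    rw [Matrix.sub_mulVec, ← Matrix.mulVec_mulVec, ← Matrix.mulVec_mulVec, heig, Matrix.mulVec_smul]
  rw [hcomm, dotProduct_sub, dotProduct_smul, Complex.sub_re, smul_eq_mul, Complex.re_ofReal_mul]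
  -- variational principle in the `2n`-particle sector
  have hvar := LiebThm1.groundEnergy_mul_norm_le H hQψN
  rw [hSU2] at hvar
  change E₀ * (star (Q *ᵥ ψ) ⬝ᵥ (Q *ᵥ ψ)).re ≤ (star (Q *ᵥ ψ) ⬝ᵥ (H *ᵥ (Q *ᵥ ψ))).re at hvar
  linarith

end Summit.HubbardSuperconductivity.HubbardSuperconductivity.Theorems.FunctionFieldCertificate
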